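import Mathlib.RepresentationTheory.Subrepresentation
import Mathlib.GroupTheory.IndexNormal
import Mathlib.Tactic.Group
import Mathlib.Tactic.NormNum
import Mathlib.Tactic.Linarith
import HarnessLib

/-!
# An irreducible plane representation has no vector fixed by an index-two subgroup (odd characteristic)
# — the representation-theoretic core of (irr_K) for `ρ̄_g|_{Γ_K}` (helper, `--supports stmt-BirchSwinnertonDyer-25505`)

Cell `bsd-stepL`, seat `bsd-stepL-imc-p1` (prover g21, 2026-08-28). Theorems only (no definition, no
named fact, no `sorry`, no instance, no notation). Part 1 of the discharge of the stub
`stub_irrK_noFixedTorsion` of the v3 line `erratum_chain` of crux 25505 `ErratumThm23SigmaLe` (part 2: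
`ErratumRoadFiveIrrKNoFixedTorsion.lean`, the arithmetic for `A_g = K²/𝒪²`).

`eq_zero_of_forall_apply_eq_of_index_two` — PURE REPRESENTATION THEORY: for a representation `π` of a
group `G` on `k²` (`k` a commutative ring with `2` a unit and `1 ≠ 0`) whose only subrepresentations are
`0` and `k²` (`IsSimpleOrder (Subrepresentation π)`, Mathlib's irreducibility), and `φ : H → G` with
image `N` of index `2`: a vector fixed by `N` is `0`. The `N`-invariants are `G`-stable since `N` is
normal; if they were everything, `G` would act through `G/N ≅ C₂` by an involution `T`; the
`±1`-eigenspaces of `T` are subrepresentations and `2` is invertible, so `T = ±1`, and then the coordinate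
line `k·e₀` is a subrepresentation strictly between `0` and `k²` — contradiction. (The dimension-`2`,
index-`2`, odd-characteristic companion of the tree's `Representation.isIrreducible_comp_of_index_two`,
which treats ODD dimension by Clifford's parity argument.) Used with `k = 𝒪/ϖ`, `π = ρ̄_g`,
`N = Γ_K ≤ Γ_ℚ` for an imaginary quadratic `K`: "`H⁰(K, A_g[ϖ]) = 0` by the irreducibility of `ρ̄_g`".

HONEST FRAMING: elementary algebra; nothing about BSD for any pair; closes: none (T7).

## References
* [Clifford1937] Thm. 1 (restriction of an irreducible representation to a normal subgroup).
* [Castella2018Erratum] Lemma 2.1, proof (p. 2: "irreducibility of `ρ̄_g|_{G_K}`"); [JetchevSkinnerWan2017] §3.1 (irr_K).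
-/

noncomputable section

-- D-0017: single-problem summit, the namespace repeats the problem name by design.
set_option linter.dupNamespace false
set_option autoImplicit false

namespace Summit.BirchSwinnertonDyer.BirchSwinnertonDyer.Theorems.ErratumThm23TwoVariable.IrrK

/-! ## §1 No fixed vector on an index-two subgroup for an irreducible plane representation -/

section RepTheory

/-- **An irreducible representation on `k²` (`2 ∈ kˣ`, `1 ≠ 0`) has no non-zero vector fixed by a
subgroup of index `2`.** The `N`-invariants (`N = φ(H)` normal of index `2`) form a subrepresentation,
hence are `0` or `k²`; in the latter case `G` acts through the involution `T = π(g)` (`g ∉ N`), whose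
`±1`-eigenspaces are subrepresentations, so `T = ±1` and the coordinate line `k·e₀` is a
subrepresentation strictly between `0` and `k²` — contradiction.
[cite: Clifford1937, Thm. 1 (restriction of an irreducible representation to a normal subgroup)] -/
theorem eq_zero_of_forall_apply_eq_of_index_two {k : Type*} [CommRing k] [Nontrivial k]
    (h2 : IsUnit (2 : k)) {G H : Type*} [Group G] [Group H]
    (π : Representation k G (Fin 2 → k)) [IsSimpleOrder (Subrepresentation π)]
    (φ : H →* G) (hφ : φ.range.index = 2)
    (v : Fin 2 → k) (hv : ∀ h : H, π (φ h) v = v) : v = 0 := by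
  classical
  set N : Subgroup G := φ.range with hNdef
  haveI hN : N.Normal := Subgroup.normal_of_index_eq_two hφ
  have hcomp : ∀ (a b : G) (w : Fin 2 → k), π a (π b w) = π (a * b) w := fun a b w ↦ by
    rw [map_mul]; rfl
  -- the `N`-invariants form a subrepresentation (normality)
  have hNfix : ∀ x ∈ N, ∀ w : Fin 2 → k, (∀ h : H, π (φ h) w = w) → π x w = w := by
    rintro _ ⟨h, rfl⟩ w hw
    exact hw h
  let W : Subrepresentation π :=
    ⟨{ carrier := {w | ∀ h : H, π (φ h) w = w}
       add_mem' := fun {a b} ha hb h ↦ by rw [map_add, ha h, hb h]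
       zero_mem' := fun h ↦ map_zero _
       smul_mem' := fun c {a} ha h ↦ by rw [map_smul, ha h] }, fun y w hw h ↦ by
      change π (φ h) (π y w) = π y w
      have hconj : y⁻¹ * φ h * y ∈ N := by
        have := hN.conj_mem (φ h) ⟨h, rfl⟩ y⁻¹
        simpa using this
      rw [hcomp, show φ h * y = y * (y⁻¹ * φ h * y) by group, ← hcomp,
        hNfix _ hconj w hw]⟩
  rcases IsSimpleOrder.eq_bot_or_eq_top W with hW | hW
  · -- no invariants
    have : v ∈ W := hv
    rw [hW] at this
    exact (Submodule.mem_bot k).1 this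
  · -- `N` acts trivially: derive a contradiction from irreducibility
    exfalso
    have htriv : ∀ x ∈ N, ∀ w : Fin 2 → k, π x w = w := fun x hx w ↦
      hNfix x hx w (show w ∈ W by rw [hW]; trivial)
    -- an element outside `N`
    obtain ⟨g, hg⟩ : ∃ g : G, g ∉ N := by
      by_contra! h
      have htop : N = ⊤ := eq_top_iff.mpr fun x _ ↦ h x
      rw [htop, Subgroup.index_top] at hφ
      exact absurd hφ (by norm_num)
    have hmul : ∀ {a b : G}, a ∉ N → b ∉ N → a * b ∈ N := fun ha hb ↦
      (Subgroup.mul_mem_iff_of_index_two hφ).mpr (iff_of_false ha hb)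
    have hginv : g⁻¹ ∉ N := fun h ↦ hg (by simpa using N.inv_mem h)
    -- `T = π g` is an involution and every `π y` is `1` or `T`
    have hTT : ∀ w, π g (π g w) = w := fun w ↦ by rw [hcomp, htriv _ (hmul hg hg)]
    have hdich : ∀ (y : G) (w : Fin 2 → k), π y w = w ∨ π y w = π g w := by
      intro y w
      by_cases hy : y ∈ N
      · exact Or.inl (htriv y hy w)
      · right
        rw [show y = (y * g⁻¹) * g by group, ← hcomp, htriv _ (hmul hy hginv)]
    -- the `±1`-eigenspaces of `T` are subrepresentations
    let Up : Subrepresentation π :=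
      ⟨{ carrier := {w | π g w = w}
         add_mem' := fun {a b} ha hb ↦ by
           change π g (a + b) = a + b
           rw [map_add, ha, hb]
         zero_mem' := map_zero _
         smul_mem' := fun c {a} ha ↦ by
           change π g (c • a) = c • a
           rw [map_smul, ha] }, fun y w hw ↦ by
        change π g (π y w) = π y w
        rcases hdich y w with h | h <;> rw [h]
        · exact hw
        · rw [show π g w = w from hw, show π g w = w from hw]⟩
    let Um : Subrepresentation π :=
      ⟨{ carrier := {w | π g w = -w}
         add_mem' := fun {a b} ha hb ↦ by
           change π g (a + b) = -(a + b)
           rw [map_add, ha, hb, neg_add]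
         zero_mem' := by change π g 0 = -0; rw [map_zero, neg_zero]
         smul_mem' := fun c {a} ha ↦ by
           change π g (c • a) = -(c • a)
           rw [map_smul, ha, smul_neg] }, fun y w hw ↦ by
        change π g (π y w) = -(π y w)
        rcases hdich y w with h | h <;> rw [h]
        · exact hw
        · rw [show π g w = -w from hw, map_neg, show π g w = -w from hw]⟩
    -- `T = ε` for `ε = 1` or `ε = -1`
    have hscalar : (∀ w, π g w = w) ∨ (∀ w, π g w = -w) := by
      rcases IsSimpleOrder.eq_bot_or_eq_top Up with hp | hp
      · rcases IsSimpleOrder.eq_bot_or_eq_top Um with hm | hm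
        · -- both eigenspaces vanish: `2 w = 0` for all `w`, absurd
          exfalso
          obtain ⟨u, hu⟩ := h2
          have hzero : ∀ w : Fin 2 → k, w = 0 := by
            intro w
            have h₁ : w + π g w ∈ Up := by
              change π g (w + π g w) = w + π g w
              rw [map_add, hTT, add_comm]
            have h₂ : w - π g w ∈ Um := by
              change π g (w - π g w) = -(w - π g w)
              rw [map_sub, hTT, neg_sub]
            rw [hp] at h₁
            rw [hm] at h₂
            have e₁ : w + π g w = 0 := (Submodule.mem_bot k).1 h₁
            have e₂ : w - π g w = 0 := (Submodule.mem_bot k).1 h₂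
            have e : (2 : k) • w = 0 := by
              rw [two_smul]
              have := congrArg₂ (· + ·) e₁ e₂
              simpa using this
            rw [← hu] at e
            have e' := congrArg (fun z ↦ ((u⁻¹ : kˣ) : k) • z) e
            simpa only [smul_smul, Units.inv_mul, one_smul, smul_zero] using e'
          have h0 := congrFun (hzero (Pi.single (M := fun _ : Fin 2 ↦ k) 0 1)) 0
          rw [Pi.single_eq_same, Pi.zero_apply] at h0
          exact one_ne_zero h0
        · exact Or.inr fun w ↦ show w ∈ Um by rw [hm]; trivial
      · exact Or.inl fun w ↦ show w ∈ Up by rw [hp]; trivial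
    -- then every `π y` is `± 1` and the coordinate line is a subrepresentation strictly between `0`, `k²`
    have hline : ∀ (y : G) (w : Fin 2 → k), π y w = w ∨ π y w = -w := by
      intro y w
      rcases hdich y w with h | h
      · exact Or.inl h
      · rcases hscalar with hs | hs
        · exact Or.inl (h.trans (hs w))
        · exact Or.inr (h.trans (hs w))
    let e₀ : Fin 2 → k := Pi.single 0 1
    let e₁ : Fin 2 → k := Pi.single 1 1
    have he₀0 : e₀ 0 = 1 := Pi.single_eq_same (M := fun _ : Fin 2 ↦ k) 0 1
    have he₀1 : e₀ 1 = 0 := Pi.single_eq_of_ne (M := fun _ : Fin 2 ↦ k) (by decide : (1 : Fin 2) ≠ 0) 1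
    have he₁1 : e₁ 1 = 1 := Pi.single_eq_same (M := fun _ : Fin 2 ↦ k) 1 1
    let L : Subrepresentation π :=
      ⟨Submodule.span k {e₀}, fun y w hw ↦ by
        rcases hline y w with h | h <;> rw [h]
        · exact hw
        · exact Submodule.neg_mem _ hw⟩
    rcases IsSimpleOrder.eq_bot_or_eq_top L with hL | hL
    · have hL' : Submodule.span k {e₀} = (⊥ : Submodule k (Fin 2 → k)) :=
        congrArg Subrepresentation.toSubmodule hL
      have hmem : e₀ ∈ Submodule.span k {e₀} := Submodule.mem_span_singleton_self e₀
      rw [hL', Submodule.mem_bot] at hmem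
      have h0 := congrFun hmem 0
      rw [he₀0, Pi.zero_apply] at h0
      exact one_ne_zero h0
    · have hL' : Submodule.span k {e₀} = (⊤ : Submodule k (Fin 2 → k)) :=
        congrArg Subrepresentation.toSubmodule hL
      have hmem : e₁ ∈ Submodule.span k {e₀} := by
        rw [hL']; exact Submodule.mem_top
      rw [Submodule.mem_span_singleton] at hmem
      obtain ⟨c, hc⟩ := hmem
      have h1 := congrFun hc 1
      rw [Pi.smul_apply, he₀1, he₁1, smul_zero] at h1
      exact one_ne_zero h1.symm

end RepTheory


end Summit.BirchSwinnertonDyer.BirchSwinnertonDyer.Theorems.ErratumThm23TwoVariable.IrrK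

end
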